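import Summits.QuantumFields.YangMills.Theorems.SwapVirialDeficitZeroModeExactRealPartLaw
import Summits.QuantumFields.YangMills.Theorems.SwapTwistDeficitToronFloorEvent
import Literature.MathematicalPhysics.QuantumFieldTheory.Balaban1983to89.T4ExpWindowSmallField
import HarnessLib

/-!
# Zero-mode EXACT rung Z5-a: the EXACT chordal ball of `SU(2)` — `Haar{u | ‖q u − q p‖ ≤ t} = (arccos(1−t²/2) − (1−t²/2)√(1−(1−t²/2)²))/π`
# (free-hands support of crux ⟨stmt-QuantumFields-24197⟩ `SwapVirialDeficit.SwapGluedStiffness`; fcl-p3 g43's plan, item Z5: «the slaved letter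
# contributes an exact Z1-type chordal ball (✓haar_fdBall_eq = fdBallMass, closed form available?)» — here is the closed form)

* §30 ★ `haar_re_ge_eq_all`: `Haar.real{u | x ≤ re(q u)} = (arccos x − x√(1−x²))/π` for EVERY real `x` (✓`haar_re_le_eq` + null level sets);
* §31 ★★★ `haar_quatBall_eq`: for `p ∈ SU(2)` and `t ≥ 0`, `Haar.real{u | ‖q u − q p‖ ≤ t} = (arccos(1−t²/2) − (1−t²/2)√(1−(1−t²/2)²))/π`
  (left invariance ✓`measure_preimage_mul` reduces to `p = 1`, and `‖q − 1‖² = 2 − 2 re q` turns the ball into the cap `re ≥ 1 − t²/2`);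
  small `t`: `= 2t³/(3π)·(1 + O(t²))`, the normalised volume of a geodesic ball of `S³`;
* §32 ★★ `fdBallMass_eq`: w2 g54's ✓`ToronFloor.fdBallMass τ` (`Haar{fd u 1 ≤ τ}`, Frobenius distance `fd = √2·‖q u − q c‖`) has the EXACT value
  `(arccos(1−τ²/4) − (1−τ²/4)√(1−(1−τ²/4)²))/π` for `τ ≥ 0` (✓`fdBallMass_ge` gave only the floor `(2/π²)τ³/256`).

HONEST LABEL: exact finite-dimensional Haar identities (plan-level zero-mode rung of a DRAFT line); NOT the fixed-`L` sharp law, NOT ⟨24197⟩; no rung /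
summit statement is proved; the Yang–Mills mass gap is NOT proved; no summit is proved by a line.  Width seat ym-line-sfw-p2-w3 g62 (cell ym-idea-1,
free hands; own crux ⟨22884⟩ blocked-on ⟨19935⟩), `--supports stmt-QuantumFields-24197`.  THEOREMS ONLY, standard axioms, 0 `sorry`.
References: [cite: Chatterjee2026YMHiggs, Lemma 5.1 / Cor. 5.2]; [folklore].
-/

set_option autoImplicit false

noncomputable section

open MeasureTheory Quaternion Set Real Filter
open scoped Quaternion ENNReal BigOperators Topology
open Literature.MathematicalPhysics.QuantumLattice
open Literature.MathematicalPhysics.QuantumFieldTheory (haarProbability)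
open Literature.MathematicalPhysics.QuantumFieldTheory.Balaban1983to89.T4HaarSU2Translate (su2Quat_quatToSU2 measurable_su2Quat
  continuous_su2Quat su2Quat_mul su2Quat_one)
open Summit.QuantumFields.YangMills.Theorems.SwapTwistDeficit.ToronLog
open Summit.QuantumFields.YangMills.Theorems.SwapTwistDeficit.ToronFloor (fdBallMass fd_le_iff)
open Summit.QuantumFields.YangMills.Theorems.FemtoTransferGap.TwoLattice.Flat (fd)

attribute [local instance] Literature.Analysis.FluidPDE.Tao2016.quatMeasurableSpace
  Literature.Analysis.FluidPDE.Tao2016.quatBorelSpace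
  Literature.MathematicalPhysics.QuantumLattice.secondCountableTopology_su2

namespace Summit.QuantumFields.YangMills.Theorems.SwapVirialDeficit.ZeroModeExact

/-! ## §30 The closed cap for every real `x` -/

/-- ★ `Haar{u | x ≤ re(q u)} = (arccos x − x√(1−x²))/π` for every real `x` (extended-real form). [folklore] -/
theorem haar_re_ge_eq_all_ofReal (x : ℝ) :
    haarProbability (Matrix.specialUnitaryGroup (Fin 2) ℂ) {u : Matrix.specialUnitaryGroup (Fin 2) ℂ | x ≤ (su2Quat u).re} =
      ENNReal.ofReal ((Real.arccos x - x * Real.sqrt (1 - x ^ 2)) / Real.pi) := by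
  have hsub : {u : Matrix.specialUnitaryGroup (Fin 2) ℂ | x < (su2Quat u).re} ⊆ {u | x ≤ (su2Quat u).re} := fun u hu => by
    simp only [Set.mem_setOf_eq] at hu ⊢; exact le_of_lt hu
  have hdiff : {u : Matrix.specialUnitaryGroup (Fin 2) ℂ | x ≤ (su2Quat u).re} \ {u | x < (su2Quat u).re} ⊆ {u | (su2Quat u).re = x} := by
    intro u hu
    rw [Set.mem_sdiff, Set.mem_setOf_eq, Set.mem_setOf_eq, not_lt] at hu
    exact le_antisymm hu.2 hu.1
  rw [← measure_eq_measure_of_null_sdiff hsub (measure_mono_null hdiff (haar_re_eq_null x)), haar_re_gt_eq_ofReal]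

/-- ★ `Haar.real{u | x ≤ re(q u)} = (arccos x − x√(1−x²))/π` for every real `x`. [folklore] -/
theorem haar_re_ge_eq_all (x : ℝ) :
    (haarProbability (Matrix.specialUnitaryGroup (Fin 2) ℂ)).real {u : Matrix.specialUnitaryGroup (Fin 2) ℂ | x ≤ (su2Quat u).re} =
      (Real.arccos x - x * Real.sqrt (1 - x ^ 2)) / Real.pi := by
  rw [measureReal_def, haar_re_ge_eq_all_ofReal, ENNReal.toReal_ofReal (div_nonneg (by linarith [mul_sqrt_le_arccos x]) Real.pi_pos.le)]

/-! ## §31 ★★★ The exact chordal ball -/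

/-- The ball around `1` is the cap `1 − t²/2 ≤ re q u` (`t ≥ 0`). [folklore] -/
theorem quatBall_one_eq_cap {t : ℝ} (ht : 0 ≤ t) :
    {u : Matrix.specialUnitaryGroup (Fin 2) ℂ | ‖su2Quat u - 1‖ ≤ t} = {u | 1 - t ^ 2 / 2 ≤ (su2Quat u).re} := by
  ext u
  simp only [Set.mem_setOf_eq]
  rw [← pow_le_pow_iff_left₀ (norm_nonneg (su2Quat u - 1)) ht two_ne_zero, Literature.MathematicalPhysics.QuantumFieldTheory.Balaban1983to89.T4ExpWindowSmallField.norm_sub_one_sq (norm_su2Quat u)]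
  constructor <;> intro h <;> linarith

/-- ★★★ **THE EXACT CHORDAL BALL**: for `p ∈ SU(2)` and `t ≥ 0`,
`Haar.real{u | ‖q u − q p‖ ≤ t} = (arccos(1 − t²/2) − (1 − t²/2)·√(1 − (1 − t²/2)²))/π`. [folklore] -/
theorem haar_quatBall_eq (p : Matrix.specialUnitaryGroup (Fin 2) ℂ) {t : ℝ} (ht : 0 ≤ t) :
    (haarProbability (Matrix.specialUnitaryGroup (Fin 2) ℂ)).real {u : Matrix.specialUnitaryGroup (Fin 2) ℂ | ‖su2Quat u - su2Quat p‖ ≤ t} =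
      (Real.arccos (1 - t ^ 2 / 2) - (1 - t ^ 2 / 2) * Real.sqrt (1 - (1 - t ^ 2 / 2) ^ 2)) / Real.pi := by
  haveI : (haarProbability (Matrix.specialUnitaryGroup (Fin 2) ℂ)).IsMulLeftInvariant := by
    rw [haarProbability_su2_eq_su2BallMeasure]; infer_instance
  -- left translation by `p⁻¹` carries the ball around `p` to the ball around `1`
  have hset : {u : Matrix.specialUnitaryGroup (Fin 2) ℂ | ‖su2Quat u - su2Quat p‖ ≤ t} =
      (fun u => p⁻¹ * u) ⁻¹' {u : Matrix.specialUnitaryGroup (Fin 2) ℂ | ‖su2Quat u - 1‖ ≤ t} := by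
    ext u
    simp only [Set.mem_setOf_eq, Set.mem_preimage]
    have hp1 : ‖su2Quat p‖ = 1 := norm_su2Quat p
    have hmul : su2Quat p * su2Quat (p⁻¹ * u) = su2Quat u := by rw [← su2Quat_mul, mul_inv_cancel_left]
    have key : su2Quat u - su2Quat p = su2Quat p * (su2Quat (p⁻¹ * u) - 1) := by rw [mul_sub, hmul, mul_one]
    rw [key, norm_mul, hp1, one_mul]
  rw [measureReal_def, hset, measure_preimage_mul, quatBall_one_eq_cap ht, ← measureReal_def, haar_re_ge_eq_all]

/-! ## §32 ★★ The exact value of `fdBallMass` -/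

/-- The Frobenius chordal ball around `1` is the cap `1 − τ²/4 ≤ re q u` (`τ ≥ 0`). [folklore] -/
theorem fdBall_one_eq_cap {τ : ℝ} (hτ : 0 ≤ τ) :
    {u : Matrix.specialUnitaryGroup (Fin 2) ℂ | fd u 1 ≤ τ} = {u | 1 - τ ^ 2 / 4 ≤ (su2Quat u).re} := by
  ext u
  simp only [Set.mem_setOf_eq]
  rw [fd_le_iff, su2Quat_one, Literature.MathematicalPhysics.QuantumFieldTheory.Balaban1983to89.T4ExpWindowSmallField.norm_sub_one_sq (norm_su2Quat u)]
  constructor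
  · rintro ⟨-, h⟩; linarith
  · intro h; exact ⟨hτ, by linarith⟩

/-- ★★ **EXACT `fdBallMass`**: `fdBallMass τ = Haar{u | ‖u − 1‖_F ≤ τ} = (arccos(1 − τ²/4) − (1 − τ²/4)·√(1 − (1 − τ²/4)²))/π` for `τ ≥ 0`
(w2 g54's ✓`ToronFloor.fdBallMass`; its ✓`fdBallMass_ge` is the floor `(2/π²)τ³/256`). [folklore] -/
theorem fdBallMass_eq {τ : ℝ} (hτ : 0 ≤ τ) :
    (fdBallMass τ).toReal = (Real.arccos (1 - τ ^ 2 / 4) - (1 - τ ^ 2 / 4) * Real.sqrt (1 - (1 - τ ^ 2 / 4) ^ 2)) / Real.pi := by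
  rw [fdBallMass, fdBall_one_eq_cap hτ, ← measureReal_def, haar_re_ge_eq_all]

end Summit.QuantumFields.YangMills.Theorems.SwapVirialDeficit.ZeroModeExact

end
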